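import Mathlib
import HarnessLib
import Literature.Analysis.FluidPDE.SelfSimilar
import Literature.Dynamics.TopologicalDynamics.UniformRecurrence
import Literature.Analysis.FluidPDE.BarkerPrange2020VorticityAlignmentTypeIHolds
import Summits.NavierStokesRegularity.NavierStokesRegularity.Theorems.PoloidalWindowDoorPoloidalWindowRigidityHotHullSlabUniform
import Summits.NavierStokesRegularity.NavierStokesRegularity.Theorems.PoloidalWindowDoorPoloidalWindowRigidityEternalCoreScalingCore

/-!
# Route `PoloidalWindowDoor`, crux `PoloidalWindowRigidity` (K2, stmt-NavierStokesRegularity-19708) — LINE 23 «eternal_core» (ns-idea-8 g11): BIRKHOFF RECURRENCE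
# under the Navier–Stokes SCALING group in a compact scaling-invariant family of class profiles (helper T2 of U2d `ScalingRecurrentCore`)

Cell ns-regularity-ideate, seat ns-poloidal-K2-p2 g14 (K2 stub-worker hand, U2d under DIRECTOR-NS #291).

`exists_scaling_recurrent`: let `Ω` be a non-empty family of profiles of the Type-I ancient mild class `A_C` which is (i) SEQUENTIALLY COMPACT AND CLOSED for
slice-wise locally uniform convergence and (ii) INVARIANT under the parabolic rescalings `nsRescale (exp σ)`, `σ ∈ ℝ`.  Then some `W ∈ Ω` is UNIFORMLY RECURRENT
under scaling: for every `ε > 0` and every compact slab `[−(n+2), −(n+2)⁻¹] × B̄_{n+2}` the set of log-scales `σ` with `nsRescale (exp σ) W` `ε`-close to `W`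
on the slab is relatively dense in `ℝ`.

PROOF — the twin of `…HotHullRecurrence.exists_uniformly_recurrent` (H6) for the scaling group: phase space `X := Ω` with the uniform structure pulled back
along `Ψ : W ↦ (n ↦ W|_{slab n}) ∈ Π n, C(slab n, ℝ³)` (countably generated ⇒ pseudo-metrisable ⇒ sequential; convergence in `X` ⇔ slice-wise locally
uniform convergence by the class-uniform KNSS moduli `…HotHullSlabUniform.tendstoUniformlyOn_slab`); the action `Φ_σ := nsRescale (exp σ)` (action law
`nsRescale_mul`, continuity `…EternalCoreScalingCore.tendsto_nsRescale_slices`); compactness from (i) (`IsSeqCompact.isCompact`); then the tree's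
Birkhoff–Furstenberg theorem `Literature.Dynamics.TopologicalDynamics.exists_isUniformlyRecurrentPt` and `isSyndetic_iff_exists_window`.

WHAT THIS IS NOT: not a claim about Navier–Stokes regularity — topological dynamics for a support of a PASSed files-only line of a door route (bears_on
LADDER-NS N0, rung N0-LocalTubeDoorPoloidal); research cells OPEN; crux 19708 / item 20428 OPEN; NS regularity NOT proved.
-/

noncomputable section

-- the summit and its single sub-problem share the name (CONVENTIONS §1), as in every Theorems file
set_option linter.dupNamespace false

namespace Summit.NavierStokesRegularity.NavierStokesRegularity.Theorems.PoloidalWindowDoorPoloidalWindowRigidityEternalCoreScalingRecurrence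

open Set Function Filter Topology Metric
open scoped NNReal Uniformity Topology
open Literature.Analysis Literature.Analysis.FluidPDE Literature.Analysis.UnboundedOperators
open Literature.Dynamics.TopologicalDynamics
open Summit.NavierStokesRegularity.NavierStokesRegularity.Theorems
open PoloidalWindowDoorPoloidalWindowRigidityHotHullSlabUniform PoloidalWindowDoorPoloidalWindowRigidityEternalCoreScalingCore

/-- **Birkhoff recurrence under scaling in a compact scaling-invariant family of class profiles.**  See the module docstring. -/
theorem exists_scaling_recurrent (C : ℝ) (Ω : Set (ℝ → EuclideanSpace ℝ (Fin 3) → EuclideanSpace ℝ (Fin 3))) (hne : Ω.Nonempty)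
    (hcls : ∀ U ∈ Ω, IsTypeIAncientMild C U)
    (hcpt : ∀ Us : ℕ → ℝ → EuclideanSpace ℝ (Fin 3) → EuclideanSpace ℝ (Fin 3), (∀ k, Us k ∈ Ω) →
      ∃ (φ : ℕ → ℕ) (U : ℝ → EuclideanSpace ℝ (Fin 3) → EuclideanSpace ℝ (Fin 3)), StrictMono φ ∧ U ∈ Ω ∧
        (∀ t < 0, TendstoLocallyUniformly (fun j => Us (φ j) t) (U t) atTop))
    (hinv : ∀ U ∈ Ω, ∀ σ : ℝ, nsRescale (Real.exp σ) U ∈ Ω) :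
    ∃ U ∈ Ω, ∀ ε : ℝ, 0 < ε → ∀ n : ℕ, ∃ L : ℝ, 0 < L ∧ ∀ a : ℝ, ∃ σ ∈ Icc a (a + L),
      ∀ t ∈ Icc (-((n : ℝ) + 2)) (-((n : ℝ) + 2)⁻¹), ∀ x ∈ closedBall (0 : EuclideanSpace ℝ (Fin 3)) ((n : ℝ) + 2),
        dist (nsRescale (Real.exp σ) U t x) (U t x) < ε := by
  classical
  have hslice : ∀ U ∈ Ω, ∀ t < 0, Continuous (U t) := fun U hU t ht => ((hcls U hU).analyticOnNhd_slice_univ ht).continuous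
  -- the phase space and the scaling action
  let X := {U : ℝ → EuclideanSpace ℝ (Fin 3) → EuclideanSpace ℝ (Fin 3) // U ∈ Ω}
  let ϕ : ℝ → X → X := fun σ U => ⟨nsRescale (Real.exp σ) U.1, hinv U.1 U.2 σ⟩
  have hϕval : ∀ σ (U : X), (ϕ σ U).1 = nsRescale (Real.exp σ) U.1 := fun σ U => rfl
  have hadd : ∀ s t (U : X), ϕ (s + t) U = ϕ s (ϕ t U) := by
    intro s t U
    apply Subtype.ext
    show nsRescale (Real.exp (s + t)) U.1 = nsRescale (Real.exp s) (nsRescale (Real.exp t) U.1)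
    rw [Real.exp_add, mul_comm, nsRescale_mul]
  -- the compact slabs and the embedding `Ψ`
  let Sn : ℕ → Set (ℝ × EuclideanSpace ℝ (Fin 3)) := fun n =>
    Icc (-((n : ℝ) + 2)) (-((n : ℝ) + 2)⁻¹) ×ˢ closedBall (0 : EuclideanSpace ℝ (Fin 3)) ((n : ℝ) + 2)
  have hSnc : ∀ n, IsCompact (Sn n) := fun n => isCompact_Icc.prod (isCompact_closedBall _ _)
  haveI hSncs : ∀ n, CompactSpace (Sn n) := fun n => isCompact_iff_compactSpace.1 (hSnc n)
  have hn2 : ∀ n : ℕ, (1 : ℝ) ≤ (n : ℝ) + 2 := fun n => by have := n.cast_nonneg (α := ℝ); linarith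
  have hSn_neg : ∀ n, ∀ p ∈ Sn n, p.1 < 0 := fun n p hp => by
    have h1 : p.1 ≤ -((n : ℝ) + 2)⁻¹ := (mem_prod.1 hp).1.2
    have h2 : (0 : ℝ) < ((n : ℝ) + 2)⁻¹ := by positivity
    linarith
  have hΨc : ∀ (U : X) (n : ℕ), Continuous fun p : Sn n => U.1 p.1.1 p.1.2 := fun U n =>
    (hcls U.1 U.2).continuousOn_uncurry.comp_continuous continuous_subtype_val fun p => ⟨hSn_neg n p.1 p.2, mem_univ _⟩
  let Ψ : X → ((n : ℕ) → C(Sn n, EuclideanSpace ℝ (Fin 3))) := fun U n => ⟨fun p => U.1 p.1.1 p.1.2, hΨc U n⟩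
  -- the phase-space topology: pulled back along `Ψ`
  letI uX : UniformSpace X := UniformSpace.comap Ψ inferInstance
  letI tX : TopologicalSpace X := uX.toTopologicalSpace
  haveI hcg : IsCountablyGenerated (𝓤 X) := by
    show IsCountablyGenerated 𝓤[UniformSpace.comap Ψ inferInstance]
    rw [uniformity_comap]
    infer_instance
  haveI : TopologicalSpace.PseudoMetrizableSpace X := inferInstance
  haveI : Nonempty X := ⟨⟨hne.some, hne.some_mem⟩⟩
  have hΨind : Topology.IsInducing Ψ := ⟨rfl⟩
  have hconvX : ∀ {Us : ℕ → X} {U : X}, Tendsto Us atTop (𝓝 U) ↔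
      ∀ n, TendstoUniformly (fun k (p : Sn n) => Ψ (Us k) n p) (Ψ U n) atTop := by
    intro Us U
    rw [hΨind.tendsto_nhds_iff, tendsto_pi_nhds]
    exact forall_congr' fun n => ContinuousMap.tendsto_iff_tendstoUniformly
  -- convergence in `X` ⇒ slice-wise locally uniform convergence
  have hX_to_slices : ∀ {Us : ℕ → X} {U : X}, Tendsto Us atTop (𝓝 U) →
      ∀ t < 0, TendstoLocallyUniformly (fun k => (Us k).1 t) (U.1 t) atTop := by
    intro Us U h t ht
    rw [hconvX] at h
    rw [tendstoLocallyUniformly_iff_forall_isCompact]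
    intro Kc hKc
    obtain ⟨r, hr⟩ := hKc.isBounded.subset_closedBall 0
    obtain ⟨n, hn⟩ := exists_nat_ge (max (max r (-t)) (-t)⁻¹)
    have hnr : r ≤ (n : ℝ) + 2 := by linarith [le_max_left (max r (-t)) (-t)⁻¹, le_max_left r (-t)]
    have ht1 : -((n : ℝ) + 2) ≤ t := by linarith [le_max_left (max r (-t)) (-t)⁻¹, le_max_right r (-t)]
    have ht2 : t ≤ -((n : ℝ) + 2)⁻¹ := by
      have h1 : (-t)⁻¹ ≤ (n : ℝ) + 2 := by linarith [le_max_right (max r (-t)) (-t)⁻¹]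
      have h2 : ((n : ℝ) + 2)⁻¹ ≤ -t := inv_le_of_inv_le₀ (by linarith) h1
      linarith
    rw [Metric.tendstoUniformlyOn_iff]
    intro ε hε
    filter_upwards [Metric.tendstoUniformly_iff.1 (h n) ε hε] with k hk x hx
    have hp : (t, x) ∈ Sn n := mem_prod.2 ⟨⟨ht1, ht2⟩, closedBall_subset_closedBall hnr (hr hx)⟩
    exact hk ⟨(t, x), hp⟩
  -- slice-wise locally uniform convergence (of members) ⇒ convergence in `X`
  have hslices_to_X : ∀ {Us : ℕ → X} {U : X}, (∀ t < 0, TendstoLocallyUniformly (fun k => (Us k).1 t) (U.1 t) atTop) →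
      Tendsto Us atTop (𝓝 U) := by
    intro Us U hsl
    rw [hconvX]
    intro n
    have hslab := tendstoUniformlyOn_slab C (u := fun k => (Us k).1) (U := U.1) (fun k => (hcls _ (Us k).2).hasTypeITimeDecay)
      (fun k => (hcls _ (Us k).2).continuousOn_uncurry) (fun k s t hst ht x => (hcls _ (Us k).2).mild_eq_heatExtension hst ht x)
      (fun k t ht => (hcls _ (Us k).2).isDivFree ht) (hcls _ U.2).hasTypeITimeDecay (hcls _ U.2).continuousOn_uncurry
      (fun s t hst ht x => (hcls _ U.2).mild_eq_heatExtension hst ht x) (fun t ht => (hcls _ U.2).isDivFree ht)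
      (fun t ht x => (hsl t ht).tendsto_comp ((hslice _ U.2 t ht).continuousAt) tendsto_const_nhds) (hn2 n)
    rw [Metric.tendstoUniformly_iff]
    intro ε hε
    filter_upwards [Metric.tendstoUniformlyOn_iff.1 hslab ε hε] with k hk p
    exact hk p.1 p.2
  -- compactness of the phase space
  have hseq : IsSeqCompact (univ : Set X) := by
    intro Us _
    obtain ⟨φ, U, hφ, hUΩ, hsl⟩ := hcpt (fun k => (Us k).1) (fun k => (Us k).2)
    exact ⟨⟨U, hUΩ⟩, mem_univ _, φ, hφ, hslices_to_X (Us := Us ∘ φ) (U := ⟨U, hUΩ⟩) hsl⟩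
  have hcompact : IsCompact (univ : Set X) := hseq.isCompact
  -- continuity of the scaling maps
  have hcontϕ : ∀ σ, Continuous (ϕ σ) := by
    intro σ
    refine continuous_iff_seqContinuous.2 fun Us U h => ?_
    apply hslices_to_X
    intro t ht
    show TendstoLocallyUniformly (fun k => nsRescale (Real.exp σ) (Us k).1 t) (nsRescale (Real.exp σ) U.1 t) atTop
    exact tendsto_nsRescale_slices (Ws := fun k => (Us k).1) (hX_to_slices h) (Real.exp_pos σ) t ht
  -- Birkhoff–Furstenberg
  obtain ⟨Ustar, -, hrec⟩ := exists_isUniformlyRecurrentPt (G := ℝ) (ϕ := ϕ) hcontϕ hadd hcompact univ_nonempty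
    (fun σ => mapsTo_univ _ _)
  refine ⟨Ustar.1, Ustar.2, fun ε hε n => ?_⟩
  set N : Set X := Ψ ⁻¹' {y | y n ∈ ball (Ψ Ustar n) ε} with hN
  have hNo : IsOpen N := (isOpen_ball.preimage (continuous_apply n)).preimage hΨind.continuous
  have hNmem : Ustar ∈ N := by
    show Ψ Ustar n ∈ ball (Ψ Ustar n) ε
    exact mem_ball_self hε
  obtain ⟨L, hL, hwin⟩ := isSyndetic_iff_exists_window.1 (hrec N (hNo.mem_nhds hNmem))
  refine ⟨L, hL, fun a => ?_⟩
  obtain ⟨σ, hσ, hσN⟩ := hwin a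
  have hd : dist (Ψ (ϕ σ Ustar) n) (Ψ Ustar n) < ε := by
    have : Ψ (ϕ σ Ustar) n ∈ ball (Ψ Ustar n) ε := hσN
    exact mem_ball.1 this
  refine ⟨σ, hσ, fun t ht x hx => ?_⟩
  exact (ContinuousMap.dist_apply_le_dist (⟨(t, x), mem_prod.2 ⟨ht, hx⟩⟩ : Sn n)).trans_lt hd

end Summit.NavierStokesRegularity.NavierStokesRegularity.Theorems.PoloidalWindowDoorPoloidalWindowRigidityEternalCoreScalingRecurrence

end
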